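import Summits.AtomisticToContinuum.BoseEinsteinCondensation.Theses.BECStronglyRayleigh
import Summits.AtomisticToContinuum.BoseEinsteinCondensation.Theorems.InsertionFieldDelocalisation.Negative.Toolkit
import Summits.AtomisticToContinuum.BoseEinsteinCondensation.Theorems.InsertionFieldDelocalisation.Negative.PerronExistence
import Summits.AtomisticToContinuum.BoseEinsteinCondensation.Theorems.BECStronglyRayleighInsertionFieldDelocalisationAmplitudePos
import Summits.AtomisticToContinuum.BoseEinsteinCondensation.Theorems.BECStronglyRayleighInsertionFieldDelocalisationEmbedding
import Literature.MathematicalPhysics.QuantumLattice.LiebMattisLadder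
import Literature.MathematicalPhysics.QuantumLattice.TokenSliding
import HarnessLib

/-!
# Stub `stub_coshBudgetIdentity` (STUB 3) of line `cosh-budget-penrose-onsager`, crux
# `BECStronglyRayleigh.InsertionFieldDelocalisation` (stmt-AtomisticToContinuum-9673)

**The cosh-budget identity** (exact). Hard-core bosons on `(ℤ/Lℤ)³` = the ferro spin-½ XY model
`H = xyTorus 3 L 1 = xxzHamiltonian 1 (torusGraph 3 L) (-1) 0` (occupied = spin up = index `0`,
`1_S = fun z => if z ∈ S then 0 else 1`; one allowed nearest-neighbour hop `S → S' = S - a + b` has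
matrix element `-½`). Let `Hψ = Eψ` with `φ_S := Re ψ(1_S) > 0` on all `k`-sets `S` (Perron), and
let `Φ` be ANY real vector supported on the `k`-set indicators, `Φ_S := Re Φ(1_S)`. Then, summing
over directed token edges `(S, a, b)` (`|S| = k`, `a ∈ S`, `b ∉ S`, `a ∼ b`, `S' = S - a + b`),

`Σ_dir (φ_S Φ_{S'} - Φ_S φ_{S'})² / (2 φ_S φ_{S'}) = 2 (Re⟨Φ, HΦ⟩ - E · Re⟨Φ, Φ⟩)`

(`cb3id_identity`). Proof: expand the square,
`(φ_S Φ_{S'} - Φ_S φ_{S'})²/(2φ_Sφ_{S'}) = φ_SΦ_{S'}²/(2φ_{S'}) + Φ_S²φ_{S'}/(2φ_S) - Φ_SΦ_{S'}`;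
the involution `(S, a, b) ↦ (S', b, a)` of the directed token edges (`card_slide`) identifies the edge sums of the
first two terms (`cb3id_hop_sum_swap`); the eigen-equation read in the occupation basis
(`mt3em_xxzZero_mulVec_ind`) is `Σ_{(a,b)} φ_{S'} = -2E φ_S` for every `S` (`cb3id_eigen_hop`), so
`Σ_dir Φ_S²φ_{S'}/(2φ_S) = -E Σ_S Φ_S² = -E · Re⟨Φ,Φ⟩`; and `Re⟨Φ,HΦ⟩ = -½ Σ_dir Φ_SΦ_{S'}`
(`cb3id_qform`). The registered stub is the specialisation `k = N + 1`, `ψ` the level-`N+1`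
admissible vector (positivity from the landed `stub_amplitudePos`), `Φ = poVec ψ'` the
Penrose–Onsager vector of the level-`N` admissible `ψ'` (real because `ψ'` is; supported on
`(N+1)`-sets because `ψ'` lives in the weight sector `L³ - N`).
-/

noncomputable section

namespace Summit.AtomisticToContinuum.BoseEinsteinCondensation.Cruxes.InsertionFieldDelocalisation.CoshBudgetPenroseOnsager

open scoped BigOperators ComplexOrder
open Literature.MathematicalPhysics.QuantumLattice Literature.Probability.LatticeModels Matrix Finset
open Summit.AtomisticToContinuum.BoseEinsteinCondensation.Theses.BECStronglyRayleigh
open Summit.AtomisticToContinuum.BoseEinsteinCondensation.Theorems.InsertionFieldDelocalisation.Negative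
open Summit.AtomisticToContinuum.BoseEinsteinCondensation.Cruxes.InsertionFieldDelocalisation.MobileTrapDirichletEigenfunction
  (mt3em_xxzZero_mulVec_ind)
open Summit.AtomisticToContinuum.BoseEinsteinCondensation.Cruxes.InsertionFieldDelocalisation.LogInsertionInfraredBound
  (stub_amplitudePos)

/-! ### Sums over configurations as sums over occupied sets -/

section Config

variable {Λ : Type*} [Fintype Λ] [DecidableEq Λ]

/-- The occupation indicator `S ↦ 1_S` is a bijection from sets of sites onto spin-½
configurations. [folklore] -/
theorem cb3id_ind_bijective :
    Function.Bijective (fun S : Finset Λ => fun z => (if z ∈ S then 0 else 1 : Fin 2)) := by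
  refine ⟨fun S S' h => (ind_eq_ind_iff S S').1 h, fun σ => ⟨univ.filter (fun z => σ z = 0), ?_⟩⟩
  funext z
  simp only [Finset.mem_filter, Finset.mem_univ, true_and]
  rcases Fin.exists_fin_two.mp ⟨σ z, rfl⟩ with h | h <;> simp [h]

/-- A sum over spin-½ configurations is a sum over occupied sets. [folklore] -/
theorem cb3id_sum_config {M : Type*} [AddCommMonoid M] (f : TensorIndex Λ 2 → M) :
    ∑ σ, f σ = ∑ S : Finset Λ, f (fun z => (if z ∈ S then 0 else 1 : Fin 2)) :=
  (cb3id_ind_bijective.sum_comp f).symm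

/-- A sum over configurations of a function supported on the `k`-set indicators is a sum over
`k`-sets. [folklore] -/
theorem cb3id_sum_config_supp {M : Type*} [AddCommMonoid M] (k : ℕ) (f : TensorIndex Λ 2 → M)
    (hf : ∀ S : Finset Λ, S.card ≠ k → f (fun z => (if z ∈ S then 0 else 1 : Fin 2)) = 0) :
    ∑ σ, f σ = ∑ S ∈ (univ : Finset Λ).powersetCard k, f (fun z => (if z ∈ S then 0 else 1 : Fin 2)) := by
  rw [cb3id_sum_config]
  symm
  refine Finset.sum_subset (Finset.subset_univ _) fun S _ hS => hf S ?_
  rwa [Finset.mem_powersetCard_univ] at hS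

/-- `Re ⟨Φ, v⟩ = Σ_i Re Φ_i · Re v_i` for a real vector `Φ`. [folklore] -/
theorem cb3id_re_dot {ι : Type*} [Fintype ι] (Φ v : ι → ℂ) (hΦ : ∀ i, (Φ i).im = 0) :
    (star Φ ⬝ᵥ v).re = ∑ i, (Φ i).re * (v i).re := by
  rw [dotProduct, Complex.re_sum]
  refine Finset.sum_congr rfl fun i _ => ?_
  simp [Complex.mul_re, hΦ i]

end Config

/-! ### Directed token edges: bookkeeping -/

section Hops

variable {Λ : Type*} [DecidableEq Λ]

/-- The vacated site is empty after the move: `a ∉ S - a + b` for `a ∈ S`, `b ∉ S`. [folklore] -/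
theorem cb3id_not_mem_move {S : Finset Λ} {a b : Λ} (ha : a ∈ S) (hb : b ∉ S) :
    a ∉ insert b (S.erase a) := by
  intro h
  rcases Finset.mem_insert.1 h with h | h
  · exact hb (h ▸ ha)
  · exact (Finset.notMem_erase a S) h

/-- Moving the token back: `(S - a + b) - b + a = S` for `a ∈ S`, `b ∉ S`. [folklore] -/
theorem cb3id_move_move {S : Finset Λ} {a b : Λ} (ha : a ∈ S) (hb : b ∉ S) :
    insert a ((insert b (S.erase a)).erase b) = S := by
  rw [Finset.erase_insert (fun h => hb (Finset.mem_of_mem_erase h)), Finset.insert_erase ha]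

/-- `Function.update 1_S x 1 = 1_{S - x}` (emptying the site `x`). [folklore] -/
theorem cb3id_update_ind (S : Finset Λ) (x : Λ) :
    Function.update (fun z => (if z ∈ S then 0 else 1 : Fin 2)) x 1 =
      fun z => (if z ∈ S.erase x then 0 else 1 : Fin 2) := by
  funext z
  by_cases hzx : z = x
  · subst hzx
    simp
  · rw [Function.update_of_ne hzx]
    simp [Finset.mem_erase, hzx]

variable [Fintype Λ] (G : SimpleGraph Λ) [DecidableRel G.Adj]

/-- The directed token edges out of the `k`-sets as one finite set of triples `(S, a, b)`.
[folklore] -/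
theorem cb3id_hop_sum_triple (k : ℕ) (g : Finset Λ → Λ → Λ → ℝ) :
    ∑ S ∈ (univ : Finset Λ).powersetCard k, ∑ a ∈ S, ∑ b,
        (if b ∉ S ∧ G.Adj a b then g S a b else 0) =
      ∑ t ∈ ((univ : Finset Λ).powersetCard k ×ˢ ((univ : Finset Λ) ×ˢ (univ : Finset Λ))).filter
          (fun t => t.2.1 ∈ t.1 ∧ t.2.2 ∉ t.1 ∧ G.Adj t.2.1 t.2.2), g t.1 t.2.1 t.2.2 := by
  rw [Finset.sum_filter, Finset.sum_product]
  refine Finset.sum_congr rfl fun S _ => ?_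
  rw [Finset.sum_product]
  dsimp only
  symm
  calc ∑ a, ∑ b, (if a ∈ S ∧ b ∉ S ∧ G.Adj a b then g S a b else 0)
      = ∑ a ∈ S, ∑ b, (if a ∈ S ∧ b ∉ S ∧ G.Adj a b then g S a b else 0) := by
        refine (Finset.sum_subset (Finset.subset_univ S) fun a _ ha => ?_).symm
        exact Finset.sum_eq_zero fun b _ => if_neg fun h => ha h.1
    _ = ∑ a ∈ S, ∑ b, (if b ∉ S ∧ G.Adj a b then g S a b else 0) :=
        Finset.sum_congr rfl fun a ha => Finset.sum_congr rfl fun b _ => by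
          simp only [ha, true_and]

/-- **The involution of directed token edges** `(S, a, b) ↦ (S - a + b, b, a)`:
`Σ_dir F(S, S') = Σ_dir F(S', S)`. [folklore] -/
theorem cb3id_hop_sum_swap (k : ℕ) (F : Finset Λ → Finset Λ → ℝ) :
    ∑ S ∈ (univ : Finset Λ).powersetCard k, ∑ a ∈ S, ∑ b,
        (if b ∉ S ∧ G.Adj a b then F S (insert b (S.erase a)) else 0) =
      ∑ S ∈ (univ : Finset Λ).powersetCard k, ∑ a ∈ S, ∑ b,
        (if b ∉ S ∧ G.Adj a b then F (insert b (S.erase a)) S else 0) := by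
  rw [cb3id_hop_sum_triple G k (fun S a b => F S (insert b (S.erase a))),
    cb3id_hop_sum_triple G k (fun S a b => F (insert b (S.erase a)) S)]
  set D := ((univ : Finset Λ).powersetCard k ×ˢ ((univ : Finset Λ) ×ˢ (univ : Finset Λ))).filter
    (fun t => t.2.1 ∈ t.1 ∧ t.2.2 ∉ t.1 ∧ G.Adj t.2.1 t.2.2) with hD
  have hmem : ∀ t : Finset Λ × (Λ × Λ),
      t ∈ D ↔ t.1.card = k ∧ t.2.1 ∈ t.1 ∧ t.2.2 ∉ t.1 ∧ G.Adj t.2.1 t.2.2 := fun t => by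
    simp only [hD, Finset.mem_filter, Finset.mem_product, Finset.mem_powersetCard_univ,
      Finset.mem_univ, and_true]
  have hmap : ∀ t ∈ D, (insert t.2.2 (t.1.erase t.2.1), t.2.2, t.2.1) ∈ D := fun t ht => by
    rw [hmem] at ht ⊢
    obtain ⟨hk, ha, hb, hadj⟩ := ht
    exact ⟨(card_slide ha hb).trans hk, Finset.mem_insert_self _ _, cb3id_not_mem_move ha hb,
      hadj.symm⟩
  have hinv : ∀ t ∈ D,
      (insert t.2.1 ((insert t.2.2 (t.1.erase t.2.1)).erase t.2.2), t.2.1, t.2.2) = t := fun t ht => by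
    obtain ⟨-, ha, hb, -⟩ := (hmem t).1 ht
    rw [cb3id_move_move ha hb]
  refine Finset.sum_nbij' (fun t => (insert t.2.2 (t.1.erase t.2.1), t.2.2, t.2.1))
    (fun t => (insert t.2.2 (t.1.erase t.2.1), t.2.2, t.2.1)) hmap hmap hinv hinv fun t ht => ?_
  obtain ⟨-, ha, hb, -⟩ := (hmem t).1 ht
  dsimp only
  rw [cb3id_move_move ha hb]

end Hops

/-! ### The hard-core Bose gas in the occupation basis -/

section Torus

variable {L : ℕ} [NeZero L]

/-- **The eigen-equation in the occupation basis** (constant local energy): for `Hψ = Eψ`,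
`H = xyTorus 3 L 1`, and every set `S`, `Σ_{a ∈ S} Σ_b [b ∉ S, a ∼ b] Re ψ(1_{S-a+b}) = -2E · Re ψ(1_S)`.
[folklore] -/
theorem cb3id_eigen_hop {E : ℝ} {ψ : TensorIndex (TorusSite 3 L) 2 → ℂ}
    (hH : (xyTorus 3 L 1) *ᵥ ψ = (E : ℂ) • ψ) (S : Finset (TorusSite 3 L)) :
    ∑ a ∈ S, ∑ b, (if b ∉ S ∧ (torusGraph 3 L).Adj a b then
        (ψ (fun z => (if z ∈ insert b (S.erase a) then 0 else 1 : Fin 2))).re else 0) =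
      -2 * E * (ψ (fun z => (if z ∈ S then 0 else 1 : Fin 2))).re := by
  have heig := congrFun hH (fun z => (if z ∈ S then 0 else 1 : Fin 2))
  rw [Pi.smul_apply, smul_eq_mul, xyTorus, mt3em_xxzZero_mulVec_ind] at heig
  have hre := congrArg Complex.re heig
  simp only [Complex.re_ofReal_mul, Complex.re_sum, apply_ite Complex.re, Complex.zero_re] at hre
  linear_combination (-2 : ℝ) * hre

/-- **The hopping action, real parts**: `Re (HΦ)(1_S) = -½ Σ_{a ∈ S} Σ_b [b ∉ S, a ∼ b] Re Φ(1_{S-a+b})`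
for `H = xyTorus 3 L 1`. [folklore] -/
theorem cb3id_mulVec_ind_re (Φ : TensorIndex (TorusSite 3 L) 2 → ℂ) (S : Finset (TorusSite 3 L)) :
    ((xyTorus 3 L 1 *ᵥ Φ) (fun z => (if z ∈ S then 0 else 1 : Fin 2))).re =
      -(1 / 2) * ∑ a ∈ S, ∑ b, (if b ∉ S ∧ (torusGraph 3 L).Adj a b then
        (Φ (fun z => (if z ∈ insert b (S.erase a) then 0 else 1 : Fin 2))).re else 0) := by
  rw [xyTorus, mt3em_xxzZero_mulVec_ind, Complex.re_ofReal_mul, Complex.re_sum]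
  simp only [Complex.re_sum, apply_ite Complex.re, Complex.zero_re]
  norm_num

/-- **The quadratic form in the occupation basis**: for a real `Φ` supported on the `k`-set
indicators, `Re⟨Φ, HΦ⟩ = -½ Σ_dir Φ_S Φ_{S'}`. [folklore] -/
theorem cb3id_qform (k : ℕ) (Φ : TensorIndex (TorusSite 3 L) 2 → ℂ) (hΦim : ∀ σ, (Φ σ).im = 0)
    (hΦsupp : ∀ S : Finset (TorusSite 3 L), S.card ≠ k →
      Φ (fun z => (if z ∈ S then 0 else 1 : Fin 2)) = 0) :
    (star Φ ⬝ᵥ (xyTorus 3 L 1) *ᵥ Φ).re =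
      -(1 / 2) * ∑ S ∈ (univ : Finset (TorusSite 3 L)).powersetCard k, ∑ a ∈ S, ∑ b,
        (if b ∉ S ∧ (torusGraph 3 L).Adj a b then
          (Φ (fun z => (if z ∈ S then 0 else 1 : Fin 2))).re *
            (Φ (fun z => (if z ∈ insert b (S.erase a) then 0 else 1 : Fin 2))).re else 0) := by
  rw [cb3id_re_dot _ _ hΦim, cb3id_sum_config_supp k
    (fun σ => (Φ σ).re * ((xyTorus 3 L 1 *ᵥ Φ) σ).re) (fun S hS => by
      simp only [hΦsupp S hS, Complex.zero_re, zero_mul]), Finset.mul_sum]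
  refine Finset.sum_congr rfl fun S _ => ?_
  rw [cb3id_mulVec_ind_re, Finset.mul_sum, Finset.mul_sum, Finset.mul_sum]
  refine Finset.sum_congr rfl fun a _ => ?_
  rw [Finset.mul_sum, Finset.mul_sum, Finset.mul_sum]
  refine Finset.sum_congr rfl fun b _ => ?_
  split_ifs <;> ring

/-- **The norm in the occupation basis**: for a real `Φ` supported on the `k`-set indicators,
`Re⟨Φ, Φ⟩ = Σ_{|S| = k} Φ_S²`. [folklore] -/
theorem cb3id_nsq (k : ℕ) (Φ : TensorIndex (TorusSite 3 L) 2 → ℂ) (hΦim : ∀ σ, (Φ σ).im = 0)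
    (hΦsupp : ∀ S : Finset (TorusSite 3 L), S.card ≠ k →
      Φ (fun z => (if z ∈ S then 0 else 1 : Fin 2)) = 0) :
    (star Φ ⬝ᵥ Φ).re =
      ∑ S ∈ (univ : Finset (TorusSite 3 L)).powersetCard k,
        (Φ (fun z => (if z ∈ S then 0 else 1 : Fin 2))).re ^ 2 := by
  rw [cb3id_re_dot _ _ hΦim, cb3id_sum_config_supp k (fun σ => (Φ σ).re * (Φ σ).re) (fun S hS => by
      simp only [hΦsupp S hS, Complex.zero_re, zero_mul])]
  exact Finset.sum_congr rfl fun S _ => (sq _).symm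

/-- **The cosh-budget identity** (general form): for `Hψ = Eψ` (`H = xyTorus 3 L 1`) with
`Re ψ(1_S) > 0` on all `k`-sets and ANY real `Φ` supported on the `k`-set indicators,
`Σ_dir (φ_SΦ_{S'} - Φ_Sφ_{S'})²/(2φ_Sφ_{S'}) = 2(Re⟨Φ,HΦ⟩ - E · Re⟨Φ,Φ⟩)`. [folklore] -/
theorem cb3id_identity (k : ℕ) (E : ℝ) (ψ Φ : TensorIndex (TorusSite 3 L) 2 → ℂ)
    (hH : (xyTorus 3 L 1) *ᵥ ψ = (E : ℂ) • ψ)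
    (hpos : ∀ S : Finset (TorusSite 3 L), S.card = k →
      0 < (ψ (fun z => (if z ∈ S then 0 else 1 : Fin 2))).re)
    (hΦim : ∀ σ, (Φ σ).im = 0)
    (hΦsupp : ∀ S : Finset (TorusSite 3 L), S.card ≠ k →
      Φ (fun z => (if z ∈ S then 0 else 1 : Fin 2)) = 0) :
    (∑ S ∈ (univ : Finset (TorusSite 3 L)).powersetCard k, ∑ a ∈ S, ∑ b,
        if b ∉ S ∧ (torusGraph 3 L).Adj a b then
          ((ψ (fun z => (if z ∈ S then 0 else 1 : Fin 2))).re *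
                (Φ (fun z => (if z ∈ insert b (S.erase a) then 0 else 1 : Fin 2))).re -
              (Φ (fun z => (if z ∈ S then 0 else 1 : Fin 2))).re *
                (ψ (fun z => (if z ∈ insert b (S.erase a) then 0 else 1 : Fin 2))).re) ^ 2 /
            (2 * (ψ (fun z => (if z ∈ S then 0 else 1 : Fin 2))).re *
              (ψ (fun z => (if z ∈ insert b (S.erase a) then 0 else 1 : Fin 2))).re)
        else 0) =
      2 * ((star Φ ⬝ᵥ (xyTorus 3 L 1) *ᵥ Φ).re - E * (star Φ ⬝ᵥ Φ).re) := by
  -- amplitudes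
  set φ : Finset (TorusSite 3 L) → ℝ := fun S => (ψ (fun z => (if z ∈ S then 0 else 1 : Fin 2))).re
    with hφ
  set α : Finset (TorusSite 3 L) → ℝ := fun S => (Φ (fun z => (if z ∈ S then 0 else 1 : Fin 2))).re
    with hα
  set P := (univ : Finset (TorusSite 3 L)).powersetCard k with hP
  -- (1) termwise expansion of the square
  have h1 : (∑ S ∈ P, ∑ a ∈ S, ∑ b, if b ∉ S ∧ (torusGraph 3 L).Adj a b then
        (φ S * α (insert b (S.erase a)) - α S * φ (insert b (S.erase a))) ^ 2 /
          (2 * φ S * φ (insert b (S.erase a))) else 0) =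
      (∑ S ∈ P, ∑ a ∈ S, ∑ b, if b ∉ S ∧ (torusGraph 3 L).Adj a b then
          φ S * α (insert b (S.erase a)) ^ 2 / (2 * φ (insert b (S.erase a))) else 0) +
        (∑ S ∈ P, ∑ a ∈ S, ∑ b, if b ∉ S ∧ (torusGraph 3 L).Adj a b then
          α S ^ 2 * φ (insert b (S.erase a)) / (2 * φ S) else 0) -
        ∑ S ∈ P, ∑ a ∈ S, ∑ b, (if b ∉ S ∧ (torusGraph 3 L).Adj a b then
          α S * α (insert b (S.erase a)) else 0) := by
    rw [← Finset.sum_add_distrib, ← Finset.sum_sub_distrib]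
    refine Finset.sum_congr rfl fun S hS => ?_
    rw [← Finset.sum_add_distrib, ← Finset.sum_sub_distrib]
    refine Finset.sum_congr rfl fun a ha => ?_
    rw [← Finset.sum_add_distrib, ← Finset.sum_sub_distrib]
    refine Finset.sum_congr rfl fun b _ => ?_
    split_ifs with hb
    · have hS' : (insert b (S.erase a)).card = k :=
        (card_slide ha hb.1).trans (Finset.mem_powersetCard_univ.1 hS)
      have h0 : φ S ≠ 0 := (hpos S (Finset.mem_powersetCard_univ.1 hS)).ne'
      have h0' : φ (insert b (S.erase a)) ≠ 0 := (hpos _ hS').ne'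
      field_simp
      ring
    · ring
  -- (2) the involution identifies the first two edge sums
  have h2 : (∑ S ∈ P, ∑ a ∈ S, ∑ b, if b ∉ S ∧ (torusGraph 3 L).Adj a b then
        φ S * α (insert b (S.erase a)) ^ 2 / (2 * φ (insert b (S.erase a))) else 0) =
      ∑ S ∈ P, ∑ a ∈ S, ∑ b, (if b ∉ S ∧ (torusGraph 3 L).Adj a b then
        α S ^ 2 * φ (insert b (S.erase a)) / (2 * φ S) else 0) := by
    rw [cb3id_hop_sum_swap (torusGraph 3 L) k (fun S S' => φ S * α S' ^ 2 / (2 * φ S'))]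
    refine Finset.sum_congr rfl fun S _ => Finset.sum_congr rfl fun a _ =>
      Finset.sum_congr rfl fun b _ => ?_
    split_ifs
    · ring
    · rfl
  -- (3) the eigen-equation evaluates the second edge sum
  have h3 : (∑ S ∈ P, ∑ a ∈ S, ∑ b, if b ∉ S ∧ (torusGraph 3 L).Adj a b then
        α S ^ 2 * φ (insert b (S.erase a)) / (2 * φ S) else 0) = -E * ∑ S ∈ P, α S ^ 2 := by
    rw [Finset.mul_sum]
    refine Finset.sum_congr rfl fun S hS => ?_
    have h0 : φ S ≠ 0 := (hpos S (Finset.mem_powersetCard_univ.1 hS)).ne'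
    have heig := cb3id_eigen_hop hH S
    calc (∑ a ∈ S, ∑ b, if b ∉ S ∧ (torusGraph 3 L).Adj a b then
          α S ^ 2 * φ (insert b (S.erase a)) / (2 * φ S) else 0)
        = α S ^ 2 / (2 * φ S) * ∑ a ∈ S, ∑ b, (if b ∉ S ∧ (torusGraph 3 L).Adj a b then
            φ (insert b (S.erase a)) else 0) := by
          rw [Finset.mul_sum]
          refine Finset.sum_congr rfl fun a _ => ?_
          rw [Finset.mul_sum]
          refine Finset.sum_congr rfl fun b _ => ?_
          split_ifs
          · ring
          · ring
      _ = -E * α S ^ 2 := by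
          rw [heig]
          field_simp
          ring
  -- (4), (5) the quadratic form and the norm in the occupation basis
  have h4 := cb3id_qform k Φ hΦim hΦsupp
  have h5 := cb3id_nsq k Φ hΦim hΦsupp
  rw [h4, h5]
  change (∑ S ∈ P, ∑ a ∈ S, ∑ b, if b ∉ S ∧ (torusGraph 3 L).Adj a b then
        (φ S * α (insert b (S.erase a)) - α S * φ (insert b (S.erase a))) ^ 2 /
          (2 * φ S * φ (insert b (S.erase a))) else 0) =
    2 * (-(1 / 2) * (∑ S ∈ P, ∑ a ∈ S, ∑ b, if b ∉ S ∧ (torusGraph 3 L).Adj a b then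
        α S * α (insert b (S.erase a)) else 0) - E * ∑ S ∈ P, α S ^ 2)
  rw [h1, h2, h3]
  ring

end Torus

/-! ### The stub -/

/-- **STUB 3 · `stub_coshBudgetIdentity` — the cosh-budget identity** (exact): for the level-`N+1`
admissible vector `ψ` of the hard-core Bose gas `xyTorus 3 L 1` (sector, `≠ 0`, eigen-equation at
the sector energy `E(N+1)`, entrywise real `≥ 0`; hence `Re ψ(1_S) > 0` on `(N+1)`-sets by
Perron–Frobenius, `stub_amplitudePos`) and the Penrose–Onsager vector `Φ = poVec ψ'` of a
level-`N` admissible `ψ'` (insert one flat particle),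
`Σ_{|S| = N+1} Σ_{a ∈ S} Σ_b [b ∉ S, a ∼ b] coshGap(Φ_S, ψ_S, Φ_{S-a+b}, ψ_{S-a+b}) = 2(Re⟨Φ,HΦ⟩ - E(N+1) Re⟨Φ,Φ⟩)`,
`coshGap a b a' b' = (b a' - a b')²/(2 b b')`. Specialisation of `cb3id_identity` (`Φ` is real and
supported on `(N+1)`-sets). [folklore] -/
theorem stub_coshBudgetIdentity :
    ∀ (L : ℕ) [NeZero L], 3 ≤ L → ∀ N : ℕ, 1 ≤ N → 2 * (N + 1) ≤ L ^ 3 →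
      ∀ ψ ψ' : TensorIndex (TorusSite 3 L) 2 → ℂ,
        (ψ ∈ spinZSector 1 (((N + 1 : ℕ) : ℝ) - (L : ℝ) ^ 3 / 2) ∧ ψ ≠ 0 ∧
          (xyTorus 3 L 1).mulVec ψ =
            ((lowestEnergyInSector 1 (xyTorus 3 L 1) (((N + 1 : ℕ) : ℝ) - (L : ℝ) ^ 3 / 2) : ℝ) : ℂ) • ψ ∧
          ∀ σ, 0 ≤ (ψ σ).re ∧ (ψ σ).im = 0) →
        (ψ' ∈ spinZSector 1 (((N : ℕ) : ℝ) - (L : ℝ) ^ 3 / 2) ∧ ψ' ≠ 0 ∧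
          (xyTorus 3 L 1).mulVec ψ' =
            ((lowestEnergyInSector 1 (xyTorus 3 L 1) (((N : ℕ) : ℝ) - (L : ℝ) ^ 3 / 2) : ℝ) : ℂ) • ψ' ∧
          ∀ σ, 0 ≤ (ψ' σ).re ∧ (ψ' σ).im = 0) →
        (∑ S ∈ (univ : Finset (TorusSite 3 L)).powersetCard (N + 1), ∑ a ∈ S, ∑ b,
          if b ∉ S ∧ (torusGraph 3 L).Adj a b then
            ((((ψ) (fun z => if z ∈ S then 0 else 1)).re * (((fun σ => ∑ x, if σ x = 0 then (ψ') (Function.update σ x 1) else 0)) (fun z => if z ∈ (insert b (S.erase a)) then 0 else 1)).re - (((fun σ => ∑ x, if σ x = 0 then (ψ') (Function.update σ x 1) else 0)) (fun z => if z ∈ S then 0 else 1)).re * ((ψ) (fun z => if z ∈ (insert b (S.erase a)) then 0 else 1)).re) ^ 2 / (2 * ((ψ) (fun z => if z ∈ S then 0 else 1)).re * ((ψ) (fun z => if z ∈ (insert b (S.erase a)) then 0 else 1)).re))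
          else 0) =
          2 * ((star ((fun σ => ∑ x, if σ x = 0 then (ψ') (Function.update σ x 1) else 0)) ⬝ᵥ (xyTorus 3 L 1).mulVec ((fun σ => ∑ x, if σ x = 0 then (ψ') (Function.update σ x 1) else 0))).re - lowestEnergyInSector 1 (xyTorus 3 L 1) (((N + 1 : ℕ) : ℝ) - (L : ℝ) ^ 3 / 2) * (star ((fun σ => ∑ x, if σ x = 0 then (ψ') (Function.update σ x 1) else 0)) ⬝ᵥ ((fun σ => ∑ x, if σ x = 0 then (ψ') (Function.update σ x 1) else 0))).re) := by
  intro L _ hL N hN hNL ψ ψ' hψ hψ'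
  obtain ⟨hψK, hψ0, hHψ, hnn⟩ := hψ
  obtain ⟨hψ'K, -, -, hnn'⟩ := hψ'
  have hNle : N ≤ L ^ 3 := by omega
  -- `ψ'` lives in the weight sector `L³ - N`
  have hM : ((Fintype.card (TorusSite 3 L) * 1 : ℕ) : ℝ) / 2 - ((L ^ 3 - N : ℕ) : ℝ) =
      (N : ℝ) - (L : ℝ) ^ 3 / 2 := by
    rw [card_torusSite, Nat.cast_sub hNle]
    push_cast
    ring
  have hψ'W : ∀ σ : TensorIndex (TorusSite 3 L) 2, (∑ z, (σ z : ℕ)) ≠ L ^ 3 - N → ψ' σ = 0 := by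
    rw [← hM] at hψ'K
    exact (LiebMattis.mem_spinZSector_weight_iff 1 (L ^ 3 - N) ψ').1 hψ'K
  refine cb3id_identity (N + 1) _ ψ
    (fun σ => ∑ x, if σ x = 0 then ψ' (Function.update σ x 1) else 0) hHψ
    (fun S hS => stub_amplitudePos L (by omega) (N + 1) (by omega) hNL ψ hψK hψ0 hHψ hnn S hS)
    (fun σ => ?_) (fun S hS => ?_)
  · -- `Φ` is real
    rw [Complex.im_sum]
    exact Finset.sum_eq_zero fun x _ => by
      split_ifs
      · exact (hnn' _).2
      · rfl
  · -- `Φ` is supported on the `(N+1)`-set indicators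
    refine Finset.sum_eq_zero fun x _ => ?_
    by_cases hx : x ∈ S
    · rw [if_pos (by simp [hx]), cb3id_update_ind]
      refine hψ'W _ ?_
      rw [weight_ind, Finset.card_compl, Finset.card_erase_of_mem hx, card_torusSite]
      have h1 := Finset.card_pos.mpr ⟨x, hx⟩
      have h2 : S.card ≤ L ^ 3 := (Finset.card_le_univ S).trans (card_torusSite 3 L).le
      omega
    · rw [if_neg (by simp [hx])]

end Summit.AtomisticToContinuum.BoseEinsteinCondensation.Cruxes.InsertionFieldDelocalisation.CoshBudgetPenroseOnsager

end
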